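import Summits.ValiantsHypothesis.ValiantsHypothesis.Theorems.BarrierLeverSuccinctHittingSetsForVPKRSTEdge
import Summits.ValiantsHypothesis.ValiantsHypothesis.Theorems.BarrierLeverSuccinctHittingSetsForVPKRSTDoor

/-!
# Crux `BarrierLever.SuccinctHittingSetsForVP` (stmt-ValiantsHypothesis-14610) — THE DIMENSION EDGE,
# part 3: `¬ KRSTSuccinctInVP ℂ c b` for every `6c ≥ 5b + 24`

The named corollary of `…KRSTEdge.lean` in the notation of `…KRSTDoor.lean` (parameters from
`Literature/Barriers/ValiantsHypothesis/AlgebraicNaturalProofsKRST.lean`): the succinct-generator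
hypothesis `KRSTDoor.KRSTSuccinctInVP ℂ c b` of the conditional `VP` statement
`KRSTDoor.succinctHittingSetsForVP_of_permanentExpHard` is FALSE whenever `6c ≥ 5b + 24` — unconditionally
(dimension count: with KRST's parameters the field size `krstPrime c n ≥ n^{6c} ≥ (n+4)^{5b+23}`
eventually, so `krst_not_succinctIn` applies). The hypothesis survives only in the band
`b > (6c − 24)/5`. Lean text by the cell planner seat `valiant-natproofs-p2` (gen 2b,
HOME/Sketch-p2g2b.lean §5, there against verbatim mirrors of the prover's definitions), landed by
the prover seat against the Literature definitions. Does NOT close the item.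

WHAT THIS IS NOT: not a lower bound; not a refutation of FSV Question 6 or of the crux — only of one
route to it (KRST's design generator, per-seed, at these parameters).

References: [KumarRamyaSaptharishiTengse2022] §3.5 and §4 (open problem 1).
-/

-- layout Summits/ValiantsHypothesis/ValiantsHypothesis forces the duplicated namespace component
set_option linter.dupNamespace false

noncomputable section

namespace Summit.ValiantsHypothesis.ValiantsHypothesis.Theorems.BarrierLever.SuccinctHittingSetsForVP

namespace KRSTEdge

open Literature.Barriers.ValiantsHypothesis Literature.Computability.AlgebraicComplexity
  Literature.Computability.MetaComplexity MvPolynomial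
open Summit.ValiantsHypothesis.ValiantsHypothesis.Theorems.BarrierLever.SuccinctHittingSetsForVP KRSTDoor

/-- **The succinct-generator hypothesis `KRSTSuccinctInVP ℂ c b` is false for every
`6c ≥ 5b + 24`:** over `ℂ`, KRST's generator with hardness exponent `c` (block `m = n^{3c}`, field
size `p = krstPrime c n ≥ n^{6c}`) is NOT `SmallCircuits ℂ n b`-succinct for any large `n` —
unconditionally (the generator has a transversal of size `≥ (n+4)^{5b+23}`, the class has
equations on any such coordinate set). [cite: KumarRamyaSaptharishiTengse2022, §4] -/
theorem not_KRSTSuccinctInVP (c b : ℕ) (hcb : 5 * b + 24 ≤ 6 * c) : ¬ KRSTSuccinctInVP ℂ c b := by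
  rintro ⟨n₀, h⟩
  obtain ⟨n₁, hn₁⟩ := threshold b
  obtain ⟨n₂, hn₂⟩ := LowDegreeEquations.eventually_mul_pow_le_two_pow 1 (5 * b + 24)
  have key : ∀ n : ℕ, n₀ + n₁ + n₂ + 4 + 2 ^ (5 * b + 23) ≤ n → False := by
    intro n hn
    have h2K : 2 ^ (5 * b + 23) ≤ n := le_trans (Nat.le_add_left _ _) hn
    have h012 : n₀ + n₁ + n₂ + 4 ≤ n := le_trans (Nat.le_add_right _ _) hn
    clear hn
    have hk1 : (n + 4) ^ (5 * b + 23) ≤ n ^ (5 * b + 24) := add_four_pow_le _ n (by omega) h2K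
    have hkn : (n + 4) ^ (5 * b + 23) ≤ 2 ^ n :=
      hk1.trans (by have h2 := hn₂ n (by omega); rwa [one_mul] at h2)
    have hkp : (n + 4) ^ (5 * b + 23) ≤ krstPrime c n := by
      refine hk1.trans ?_
      calc n ^ (5 * b + 24) ≤ n ^ (6 * c) := Nat.pow_le_pow_right (by omega) hcb
        _ = krstBlock c n * krstBlock c n := by
            rw [krstBlock, ← pow_add, show 3 * c + 3 * c = 6 * c by omega]
        _ ≤ krstPrime c n := krstBlock_sq_le_krstPrime c n
    have hm : 2 ≤ krstBlock c n :=
      calc 2 ≤ n := by omega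
        _ ≤ n ^ (3 * c) := Nat.le_self_pow (by omega) n
    exact krst_not_succinctIn hm (krstBlock_sq_le_krstPrime c n) (by omega) hkp hkn (hn₁ n (by omega))
      (h n (by omega))
  exact key _ le_rfl

/-- Hence the conditional `VP` statement `succinctHittingSetsForVP_of_permanentExpHard` (hardness
∧ `KRSTSuccinctInVP F c b` ⇒ FSV Question 6) has a satisfiable second hypothesis over `ℂ` only if
`6c < 5b + 24`, i.e. `b > (6c − 24)/5` — the band in which the succinct-generator conjecture for
KRST's design is open. [cite: KumarRamyaSaptharishiTengse2022, §4] -/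
theorem lt_of_KRSTSuccinctInVP {c b : ℕ} (h : KRSTSuccinctInVP ℂ c b) : 6 * c < 5 * b + 24 := by
  by_contra hle
  exact not_KRSTSuccinctInVP c b (not_lt.mp hle) h

end KRSTEdge

end Summit.ValiantsHypothesis.ValiantsHypothesis.Theorems.BarrierLever.SuccinctHittingSetsForVP

end
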